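import Literature.NumberTheory.Automorphic.SLTwoTreeQuadraticTorusShellValues   -- ★ p843959 F0P3a-p08 (g15) (W′3)-TREE: `forall_valuation_shellConj_sub_shellConj_le`, `forall_valuation_shellConj_sub_scalar_le` (+ ★ A-p17 (W′1) I, ★ p843859 ALG)
import HarnessLib

/-!
# Window values are LEVEL-`j` RIGID: the value of a right-`K(j)`-invariant class function at a torus-fixed shell-`m` vertex is constant on `(a, bϖ^{−m})`-balls of radius `|ϖ|^j`,
# and deep shells read the centre (Labesse–Langlands 1979 §2 (2.1), p. 9 — the `hΨ`-side input of the wild END)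

Topic `NumberTheory/Automorphic`; namespace `Literature.NumberTheory.Automorphic.HermitianLatticeTree` (ROAD W's).  THEOREMS ONLY (no definition, no instance, no notation,
no named fact, no `sorry`).  Cell `pub/hodgecm-mathlib` (D-0151), crux H413 = `stmt-HodgeConjecture-24833`; road «W′» = «R1LL-WILD» (LEAD F0P3a-plan (g10) WORD T9-25;
architect A-p16 (g28) census W′-v1 1a27d591), brick **(W′3)-III** (F0P3a-p08 (g15), census-first 12:1xZ): the wild twin of the inert road's ★ S3
`isLocallyConstant_apply_symm_frameScalar` (F0P3-p01 p843589) — there the coefficient functions `t ↦ φ_k(X_i(τ₁ t), t.2)` were shown locally constant from a right-level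
invariance of `φ_k`; here the same mechanism is isolated as pure `GL₂(F)` bookkeeping over the (W′3) shell matrices, so that the END-WILD (p04 (g14), (W′6a)) gets its `hΨ`
(«`Ψ` eventually constant at every singular point») from the continuity of the frame entries (★ p843400 `continuous_frameEntry*`) alone.  HONEST LABEL: HC_CM is proved only
modulo the printed citations (the 2 remaining named inputs hLiu418, h413) until rung 0 closes; nothing printed is asserted (valuation bookkeeping).

CONTENTS (`F` a field with `[ValuativeRel F]`; `ϖ` with `|ϖ| ≤ 1`; the «level» is any bound `q` in the value group, typically `|ϖ|^j`)
* §1 `forall_valuation_coe_inv_mul_sub_one_le` — if `X ∈ GL₂(𝒪)` and `X′` is entrywise `q`-close to `X` then `X⁻¹X′` is entrywise `q`-close to `1` («close to an integral point ⇒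
  right-congruent modulo the level»: `X⁻¹X′ − 1 = X⁻¹(X′ − X)` with `X⁻¹` integral, ultrametric sums).
* §2 **`apply_eq_apply_of_forall_valuation_sub_le`** — for `φ : GL₂(F) → Y` right-invariant under the level-`q` congruence elements (`∀ y k, (∀ r s, |(k − 1) r s| ≤ q) → φ (y k) = φ y`):
  `X ∈ GL₂(𝒪)`, `X′` entrywise `q`-close to `X` ⇒ `φ X′ = φ X`.
* §3 **`apply_shellConj_eq_apply_shellConj_of_le`** — THE WINDOW RIGIDITY: two torus elements `γ = (a, bv; b, a+bu)`, `γ′ = (a′, b′v; b′, a′+b′u)` (`u v a b a′ b′ ∈ 𝒪`, `|det γ| = 1`)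
  read at a COMMON fixed shell `m` (`|b| ≤ |ϖ|^m`) with `max |a − a′| |b(ϖ^m)⁻¹ − b′(ϖ^m)⁻¹| ≤ q` give the SAME value `φ(g_m⁻¹ γ′ g_m) = φ(g_m⁻¹ γ g_m)` — LL p. 9 «`f(a, b²v∕x; x, a + bu) =
  f(a₀, 0; x, a₀)` for `N` large» in its level-`j` form; dyadic-safe (no `2`, no residue squares).
* §4 **`apply_shellConj_eq_apply_scalar_of_le`** — DEEP SHELLS READ THE CENTRE: if `|a| = 1` and `|b (ϖ^m)⁻¹| ≤ q` then `φ(g_m⁻¹ γ g_m) = φ(a·1)` (★ `forall_valuation_shellConj_sub_scalar_le`).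

## References
* [LabesseLanglands1979] J.-P. Labesse, R. P. Langlands, *L-indistinguishability for SL(2)*, Canad. J. Math. 31 (1979) 726–785: §2 (2.1) p. 8; p. 9 (the deep shells and the
  window: «if `γ` is close to a scalar `a₀` and `N` therefore very large then `f(a, b²v∕x; x, a+bu) = f(a₀, 0; x, a₀)`»).
* [Serre1980Trees] J.-P. Serre, *Trees* (1980), Ch. II §1.3 (`GL₂(𝒪)` and its congruence subgroups as vertex ∕ ball stabilisers).
-/

set_option autoImplicit false

noncomputable section

open scoped ValuativeRel Matrix MatrixGroups
open Matrix ValuativeRel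

namespace Literature.NumberTheory.Automorphic.HermitianLatticeTree

open Literature.NumberTheory.Automorphic Literature.NumberTheory.LocalFields

variable {F : Type*} [Field F] [ValuativeRel F]

/-! ## §1 Entrywise close to an integral point ⇒ right-congruent modulo the level -/

/-- An ultrametric two-term product bound: `|x₁ y₁ + x₂ y₂| ≤ q` when `|xᵢ| ≤ 1` and `|yᵢ| ≤ q`. [cite: Serre1980Trees, Ch. II §1.3] -/
theorem valuation_mul_add_mul_le {x₁ x₂ y₁ y₂ : F} {q : ValueGroupWithZero F} (hx₁ : valuation F x₁ ≤ 1) (hx₂ : valuation F x₂ ≤ 1)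
    (hy₁ : valuation F y₁ ≤ q) (hy₂ : valuation F y₂ ≤ q) : valuation F (x₁ * y₁ + x₂ * y₂) ≤ q := by
  refine Valuation.map_add_le _ ?_ ?_
  · rw [map_mul]
    calc valuation F x₁ * valuation F y₁ ≤ 1 * q := mul_le_mul' hx₁ hy₁
      _ = q := one_mul q
  · rw [map_mul]
    calc valuation F x₂ * valuation F y₂ ≤ 1 * q := mul_le_mul' hx₂ hy₂
      _ = q := one_mul q

/-- **Close to an integral point ⇒ right-congruent modulo the level**: if `X ∈ GL₂(𝒪)` and every entry of `X′ − X` has valuation `≤ q`, then every entry of `X⁻¹X′ − 1` has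
valuation `≤ q` (`X⁻¹X′ − 1 = X⁻¹(X′ − X)` and `X⁻¹` is integral). [cite: Serre1980Trees, Ch. II §1.3] -/
theorem forall_valuation_coe_inv_mul_sub_one_le {X X' : GL (Fin 2) F} (hX : X ∈ glInt 2 F) {q : ValueGroupWithZero F}
    (hq : ∀ r s, valuation F (((X' : Matrix (Fin 2) (Fin 2) F) - (X : Matrix (Fin 2) (Fin 2) F)) r s) ≤ q) :
    ∀ r s, valuation F ((((X⁻¹ * X' : GL (Fin 2) F) : Matrix (Fin 2) (Fin 2) F) - 1) r s) ≤ q := by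
  have hinv := isIntegralMatrix_inv_of_mem_glInt hX
  have hXi : ∀ r k, valuation F (((X⁻¹ : GL (Fin 2) F) : Matrix (Fin 2) (Fin 2) F) r k) ≤ 1 :=
    fun r k => (Valuation.mem_integer_iff _ _).1 (hinv r k)
  have hkey : (((X⁻¹ * X' : GL (Fin 2) F)) : Matrix (Fin 2) (Fin 2) F) - 1 =
      ((X⁻¹ : GL (Fin 2) F) : Matrix (Fin 2) (Fin 2) F) * ((X' : Matrix (Fin 2) (Fin 2) F) - (X : Matrix (Fin 2) (Fin 2) F)) := by
    rw [Matrix.mul_sub, Units.val_mul, Units.inv_mul]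
  intro r s
  rw [hkey, Matrix.mul_apply, Fin.sum_univ_two]
  exact valuation_mul_add_mul_le (hXi r 0) (hXi r 1) (hq 0 s) (hq 1 s)

/-! ## §2 Right-level-invariant functions do not see `q`-perturbations of integral points -/

/-- **Level rigidity of a right-`K(q)`-invariant function**: if `φ (y k) = φ y` whenever `k` is entrywise `q`-congruent to `1`, then for `X ∈ GL₂(𝒪)` and `X′` entrywise
`q`-close to `X`, `φ X′ = φ X` (apply the hypothesis to `k = X⁻¹X′`, §1). [cite: LabesseLanglands1979, §2 p. 9] [cite: Serre1980Trees, Ch. II §1.3] -/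
theorem apply_eq_apply_of_forall_valuation_sub_le {Y : Sort*} (φ : GL (Fin 2) F → Y) {q : ValueGroupWithZero F}
    (hφ : ∀ y k : GL (Fin 2) F, (∀ r s, valuation F (((k : Matrix (Fin 2) (Fin 2) F) - 1) r s) ≤ q) → φ (y * k) = φ y)
    {X X' : GL (Fin 2) F} (hX : X ∈ glInt 2 F) (hq : ∀ r s, valuation F (((X' : Matrix (Fin 2) (Fin 2) F) - (X : Matrix (Fin 2) (Fin 2) F)) r s) ≤ q) :
    φ X' = φ X := by
  have h := hφ X (X⁻¹ * X') (forall_valuation_coe_inv_mul_sub_one_le hX hq)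
  rwa [mul_inv_cancel_left] at h

/-! ## §3 The window rigidity at a fixed shell -/

variable {ϖ : F}

/-- The shell conjugate of a torus element with unit norm, read at a FIXED shell (`|b| ≤ |ϖ|^m`, `a b u v ∈ 𝒪`, `ϖ ∈ 𝒪 ∖ {0}`), lies in `GL₂(𝒪)`.
(★ A-p17 `isIntegralMatrix_shellConj_iff` + `det (g_m⁻¹ γ g_m) = det γ`.) [cite: LabesseLanglands1979, §2 (2.1) p. 8] -/
theorem shellConj_mem_glInt {u v a b : F} (hu : u ∈ 𝒪[F]) (hv : v ∈ 𝒪[F]) (ha : a ∈ 𝒪[F]) (hb : b ∈ 𝒪[F]) (hϖO : ϖ ∈ 𝒪[F]) (hϖ0 : ϖ ≠ 0)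
    {γ gm : GL (Fin 2) F} (hγ : (γ : Matrix (Fin 2) (Fin 2) F) = !![a, b * v; b, a + b * u]) (hγdet : valuation F (γ : Matrix (Fin 2) (Fin 2) F).det = 1)
    {m : ℕ} (hgm : (gm : Matrix (Fin 2) (Fin 2) F) = Matrix.diagonal ![1, ϖ ^ m]) (hbm : valuation F b ≤ valuation F ϖ ^ m) :
    gm⁻¹ * γ * gm ∈ glInt 2 F := by
  have hm : ϖ ^ m ≠ 0 := pow_ne_zero m hϖ0
  have hmO : ϖ ^ m ∈ 𝒪[F] := Subring.pow_mem _ hϖO m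
  refine mem_glInt_of_isIntegralMatrix ?_ ?_
  · rw [coe_inv_mul_torus_mul_of_coe_eq_diagonal u v a b hγ hgm hm]
    exact (isIntegralMatrix_shellConj_iff hu hv ha hb hmO hm).2 (by rwa [map_pow])
  · rw [Units.val_mul, Units.val_mul, Matrix.det_units_conj', hγdet]

/-- **THE WINDOW RIGIDITY** (LL p. 9 in level-`j` form; the `hΨ`-side input of the wild END): `γ = (a, bv; b, a+bu)`, `γ′ = (a′, b′v; b′, a′+b′u)` with `u v a b ∈ 𝒪`, `|det γ| = 1`,
read at a common FIXED shell `m` (`|b| ≤ |ϖ|^m`; `ϖ ∈ 𝒪 ∖ {0}`), and `max |a − a′| |b(ϖ^m)⁻¹ − b′(ϖ^m)⁻¹| ≤ q`; then for every `φ` right-invariant under the level-`q` congruence elements,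
`φ(g_m⁻¹ γ′ g_m) = φ(g_m⁻¹ γ g_m)` — the window value at shell `m` is constant on `(a, bϖ^{−m})`-balls of radius `q` (§2 at `X = g_m⁻¹ γ g_m ∈ GL₂(𝒪)` via ★
`forall_valuation_shellConj_sub_shellConj_le`).  Dyadic-safe: no `2`, no residue squares. [cite: LabesseLanglands1979, §2 (2.1) p. 8; p. 9] -/
theorem apply_shellConj_eq_apply_shellConj_of_le {Y : Sort*} (φ : GL (Fin 2) F → Y) {q : ValueGroupWithZero F}
    (hφ : ∀ y k : GL (Fin 2) F, (∀ r s, valuation F (((k : Matrix (Fin 2) (Fin 2) F) - 1) r s) ≤ q) → φ (y * k) = φ y)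
    {u v a b a' b' : F} (hu : u ∈ 𝒪[F]) (hv : v ∈ 𝒪[F]) (ha : a ∈ 𝒪[F]) (hb : b ∈ 𝒪[F]) (hϖO : ϖ ∈ 𝒪[F]) (hϖ0 : ϖ ≠ 0)
    {γ γ' gm : GL (Fin 2) F} (hγ : (γ : Matrix (Fin 2) (Fin 2) F) = !![a, b * v; b, a + b * u]) (hγdet : valuation F (γ : Matrix (Fin 2) (Fin 2) F).det = 1)
    (hγ' : (γ' : Matrix (Fin 2) (Fin 2) F) = !![a', b' * v; b', a' + b' * u])
    {m : ℕ} (hgm : (gm : Matrix (Fin 2) (Fin 2) F) = Matrix.diagonal ![1, ϖ ^ m]) (hbm : valuation F b ≤ valuation F ϖ ^ m)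
    (hclose : max (valuation F (a - a')) (valuation F (b * (ϖ ^ m)⁻¹ - b' * (ϖ ^ m)⁻¹)) ≤ q) :
    φ (gm⁻¹ * γ' * gm) = φ (gm⁻¹ * γ * gm) := by
  have hm : ϖ ^ m ≠ 0 := pow_ne_zero m hϖ0
  have hϖ1 : valuation F ϖ ≤ 1 := (Valuation.mem_integer_iff _ _).1 hϖO
  refine apply_eq_apply_of_forall_valuation_sub_le φ hφ (shellConj_mem_glInt hu hv ha hb hϖO hϖ0 hγ hγdet hgm hbm) ?_
  intro r s
  rw [coe_inv_mul_torus_mul_of_coe_eq_diagonal u v a' b' hγ' hgm hm, coe_inv_mul_torus_mul_of_coe_eq_diagonal u v a b hγ hgm hm]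
  -- `(2.1)(a′,b′) − (2.1)(a,b)`: swap the roles and use ★ `forall_valuation_shellConj_sub_shellConj_le`
  have h := forall_valuation_shellConj_sub_shellConj_le (ϖ := ϖ) hu hv hϖ0 hϖ1 m a' b' a b r s
  refine le_trans h ?_
  rwa [← neg_sub a a', Valuation.map_neg, ← neg_sub (b * (ϖ ^ m)⁻¹), Valuation.map_neg]

/-! ## §4 Deep shells read the centre -/

omit [ValuativeRel F] in
/-- The scalar `a·1 ∈ GL₂(F)` (`a ≠ 0`) has matrix `a • 1`. [cite: Serre1980Trees, Ch. II §1.2] -/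
theorem coe_units_mk0_map_scalar {a : F} (ha : a ≠ 0) :
    (((Units.mk0 a ha).map ((Matrix.scalar (Fin 2) : F →+* Matrix (Fin 2) (Fin 2) F) : F →* Matrix (Fin 2) (Fin 2) F) : GL (Fin 2) F) : Matrix (Fin 2) (Fin 2) F) =
      a • (1 : Matrix (Fin 2) (Fin 2) F) := by
  rw [coe_units_map_scalar, Units.val_mk0]

/-- A unit scalar lies in `GL₂(𝒪)`. [cite: Serre1980Trees, Ch. II §1.3] -/
theorem units_mk0_map_scalar_mem_glInt {a : F} (ha1 : valuation F a = 1) :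
    (Units.mk0 a (fun h => by rw [h, map_zero] at ha1; exact zero_ne_one ha1)).map
        ((Matrix.scalar (Fin 2) : F →+* Matrix (Fin 2) (Fin 2) F) : F →* Matrix (Fin 2) (Fin 2) F) ∈ glInt 2 F := by
  have ha0 : a ≠ 0 := fun h => by rw [h, map_zero] at ha1; exact zero_ne_one ha1
  refine mem_glInt_of_isIntegralMatrix ?_ ?_
  · intro i j
    rw [coe_units_mk0_map_scalar ha0, Matrix.smul_apply, Matrix.one_apply, smul_eq_mul, Valuation.mem_integer_iff]
    split_ifs
    · rw [mul_one]; exact ha1.le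
    · rw [mul_zero, map_zero]; exact zero_le
  · rw [coe_units_mk0_map_scalar ha0, Matrix.det_smul, Matrix.det_one, mul_one, Fintype.card_fin, map_pow, ha1, one_pow]

/-- **DEEP SHELLS READ THE CENTRE** (LL p. 9): `γ = (a, bv; b, a+bu)` with `u v ∈ 𝒪`, `|a| = 1`, `ϖ ∈ 𝒪 ∖ {0}`; at a shell `m` so deep that `|b (ϖ^m)⁻¹| ≤ q`, every `φ` right-invariant under
the level-`q` congruence elements takes at `g_m⁻¹ γ g_m` the value it takes at the SCALAR `a·1` (★ `forall_valuation_shellConj_sub_scalar_le` + §2) — these are the shells whose total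
contribution (W′4) cancels against the ramified character. [cite: LabesseLanglands1979, §2 p. 9] -/
theorem apply_shellConj_eq_apply_scalar_of_le {Y : Sort*} (φ : GL (Fin 2) F → Y) {q : ValueGroupWithZero F}
    (hφ : ∀ y k : GL (Fin 2) F, (∀ r s, valuation F (((k : Matrix (Fin 2) (Fin 2) F) - 1) r s) ≤ q) → φ (y * k) = φ y)
    {u v a b : F} (hu : u ∈ 𝒪[F]) (hv : v ∈ 𝒪[F]) (ha1 : valuation F a = 1) (hϖO : ϖ ∈ 𝒪[F]) (hϖ0 : ϖ ≠ 0)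
    {γ gm : GL (Fin 2) F} (hγ : (γ : Matrix (Fin 2) (Fin 2) F) = !![a, b * v; b, a + b * u])
    {m : ℕ} (hgm : (gm : Matrix (Fin 2) (Fin 2) F) = Matrix.diagonal ![1, ϖ ^ m]) (hdeep : valuation F (b * (ϖ ^ m)⁻¹) ≤ q) :
    φ (gm⁻¹ * γ * gm) =
      φ ((Units.mk0 a (fun h => by rw [h, map_zero] at ha1; exact zero_ne_one ha1)).map
        ((Matrix.scalar (Fin 2) : F →+* Matrix (Fin 2) (Fin 2) F) : F →* Matrix (Fin 2) (Fin 2) F)) := by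
  have hm : ϖ ^ m ≠ 0 := pow_ne_zero m hϖ0
  have ha0 : a ≠ 0 := fun h => by rw [h, map_zero] at ha1; exact zero_ne_one ha1
  have hϖ1 : valuation F ϖ ≤ 1 := (Valuation.mem_integer_iff _ _).1 hϖO
  refine apply_eq_apply_of_forall_valuation_sub_le φ hφ (units_mk0_map_scalar_mem_glInt ha1) ?_
  intro r s
  rw [coe_inv_mul_torus_mul_of_coe_eq_diagonal u v a b hγ hgm hm, coe_units_mk0_map_scalar ha0]
  exact le_trans (forall_valuation_shellConj_sub_scalar_le (ϖ := ϖ) hu hv hϖ0 hϖ1 m a b r s) hdeep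

end Literature.NumberTheory.Automorphic.HermitianLatticeTree

end
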